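import Literature.Analysis.FluidPDE.KochTataru
import Literature.Analysis.UnboundedOperators.HeatKernelHeatEquation
import Mathlib.MeasureTheory.Function.SpecialFunctions.Inner
import HarnessLib

/-!
# Koch–Tataru's kernel bound (14): size, measurability and `L¹` norm of the Oseen–Koch–Tataru kernel

Analysis/FluidPDE proof companion of `Literature/Analysis/FluidPDE/KochTataru.lean` (the
decomposition of the named fact `Literature.Analysis.FluidPDE.koch_tataru`, **ns.S15**,
Koch–Tataru, Adv. Math. 157 (2001), Theorem 2, into the named facts (L1) bilinear estimate,
(T3) integral ⇒ class, (T4) class ⇒ integral; (L2), (T1), (T2) are discharged in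
`KochTataruLinear.lean`, `KochTataruFixedPoint.lean`). All three remaining facts rest on the
analysis of the explicit kernel `K(τ, z)[a, b] = oseenKernel τ z a b` of `e^{τΔ} Π ∇·`, and this
file supplies its first layer, everything **proved**:

* `exists_heatKernel_le_rpow`: the Gauss–Weierstrass kernel against the parabolic distance,
  `G_s(z) ≤ C_e s^{e-d/2} (s + ‖z‖²)^{-e}` for every real `e` (from `x^k e^{-x} ≤ k!`);
* `exists_oseenWeightA_le`, `exists_oseenWeightB_le`: the Gaussian weights
  `A(τ,z) = ∫_τ^∞ G_s(z)/(4s²) ds`, `B(τ,z) = ∫_τ^∞ G_s(z)/(8s³) ds` of `oseenKernel` are absolutely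
  convergent, nonnegative, and `A ≤ C (τ + ‖z‖²)^{-d/2-1}`, `B ≤ C (τ + ‖z‖²)^{-d/2-2}`
  (`exists_setIntegral_heatKernel_div_le`: `∫_τ^∞ (s + ‖z‖²)^{-d/2-n} ds` in closed form);
* `exists_norm_oseenKernel_le`: **Koch–Tataru's (14)**,
  `‖K(τ, z)[a, b]‖ ≤ C (τ + ‖z‖²)^{-(d+1)/2} ‖a‖ ‖b‖` (`τ > 0`), the parabolic form of
  `|K(x,t)| ≤ c(√t + |x|)^{-n-1}`;
* `stronglyMeasurable_oseenWeightA/B`, `measurable_oseenKernel`: joint measurability of the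
  weights in `(τ, z) ∈ ℝ × E` and of the kernel in `(τ, z, a, b)`, on the whole space including
  the junk region `τ ≤ 0` (the half-line `(τ, ∞)` is the indicator of the measurable set
  `{τ < s}`, so Fubini measurability applies with no case distinction) — this is what makes the
  Duhamel integrands `(s, y) ↦ K(t - s, x - y)[u(s,y), v(s,y)]` of `kochTataruBilinear`
  measurable for measurable `u`, `v`;
* `integral_add_norm_sq_rpow_neg`, `lintegral_add_norm_sq_rpow_neg`: the parabolic scaling
  `∫ (τ + ‖z‖²)^{-e} dz = τ^{d/2-e} ∫ (1 + ‖w‖²)^{-e} dw` (`2e > d`), and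
  `exists_lintegral_enorm_oseenKernel_le`: `∫ ‖K(τ, z)[a, b]‖ dz ≤ C τ^{-1/2} ‖a‖ ‖b‖`
  ("integrability of the kernel at `0`", Koch–Tataru, proof of Lemma 3.2, Step 2).

Constants are existential (`∃ C > 0`) and depend only on `E`; all statements hold in every
finite dimension `d = dim E` (for `d = 1` the kernel is not zero termwise but the bounds are
still true). Not in this file: the gradient structure `K = (D_aG_τ) b - ∇ D_a D_b E_τ`,
`div_z K = 0`, the adjoint identity against divergence-free tests and the semigroup law (the
next layer), and the space–time estimates of Lemma 3.2 themselves.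

## Mathlib / tree search

Tree: `UnboundedOperators.heatKernel`, `heatKernel_pos`, `heatKernel_le`,
`contDiffOn_uncurry_heatKernel` (`HeatKernelHeatEquation`), `norm_oseenKernel_le` and the
bilinearity API of `KochTataru.lean`. Mathlib: `Real.pow_div_factorial_le_exp`, `add_pow_le`,
`integral_Ioi_rpow_of_lt`, `integrableOn_Ioi_rpow_of_lt`, `MeasurePreserving.setIntegral_preimage_emb`
(translation on `Ioi`), `StronglyMeasurable.integral_prod_right`, `Measurable.inner`,
`Measure.integral_comp_smul`, `integrable_comp_smul_iff`, `integrable_rpow_neg_one_add_norm_sq`,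
`ofReal_integral_eq_lintegral_ofReal`. Nothing is duplicated (`lean search 'oseen|heatKernel_le_rpow|
add_norm_sq_rpow'`).

## References

* H. Koch, D. Tataru, *Well-posedness for the Navier–Stokes equations*, Adv. Math. 157 (2001)
  22–35, §2 ((6)–(8): the kernels of `ΠS(t)`, `Π∇S(t)`), §3 ((11), (14), Lemma 3.2 Step 2).
  Bib key `KochTataruAdvMath2001` (held: doi:10.1006/aima.2000.1937, pp. 5–7 of the preprint).
-/

noncomputable section

open MeasureTheory Set Function Filter Topology Metric Real
open scoped ENNReal NNReal RealInnerProductSpace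

namespace Literature.Analysis.FluidPDE

/-! ## An elementary exponential bound -/

section Elementary

/-- `(1 + x)^k e^{-x} ≤ 2^k (1 + k!)` for `x ≥ 0`: polynomial growth loses against the
exponential (`x^k/k! ≤ e^x`). [folklore] -/
theorem one_add_pow_mul_exp_neg_le (k : ℕ) {x : ℝ} (hx : 0 ≤ x) :
    (1 + x) ^ k * Real.exp (-x) ≤ 2 ^ k * (1 + k.factorial) := by
  have h1 : (1 + x) ^ k ≤ 2 ^ (k - 1) * (1 ^ k + x ^ k) := add_pow_le zero_le_one hx k
  rw [one_pow] at h1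
  have h2 : x ^ k * Real.exp (-x) ≤ k.factorial := by
    have := Real.pow_div_factorial_le_exp x hx k
    rw [div_le_iff₀ (by positivity)] at this
    rw [Real.exp_neg, mul_inv_le_iff₀ (Real.exp_pos x)]
    linarith
  have h3 : Real.exp (-x) ≤ 1 := by
    rw [Real.exp_le_one_iff]; linarith
  have h4 : (2 : ℝ) ^ (k - 1) ≤ 2 ^ k := pow_le_pow_right₀ one_le_two (Nat.sub_le k 1)
  calc (1 + x) ^ k * Real.exp (-x) ≤ 2 ^ (k - 1) * (1 + x ^ k) * Real.exp (-x) := by gcongr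
    _ = 2 ^ (k - 1) * (Real.exp (-x) + x ^ k * Real.exp (-x)) := by ring
    _ ≤ 2 ^ k * (1 + k.factorial) := by gcongr

/-- `e^{-x} ≤ 8^k (1 + k!) (1 + 4x)^{-e}` for `x ≥ 0`, `e ≤ k`: the form of the exponential
bound used for the heat kernel, where `1 + 4x = (s + ‖z‖²)/s` for `x = ‖z‖²/(4s)`. [folklore] -/
theorem exp_neg_le_mul_one_add_rpow_neg {k : ℕ} {e : ℝ} (hek : e ≤ k) {x : ℝ}
    (hx : 0 ≤ x) :
    Real.exp (-x) ≤ 8 ^ k * (1 + k.factorial) * (1 + 4 * x) ^ (-e) := by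
  have h14 : (1 : ℝ) ≤ 1 + 4 * x := by linarith
  have hpos : (0 : ℝ) < 1 + 4 * x := by linarith
  -- `(1 + 4x)^e ≤ (1 + 4x)^k ≤ 4^k (1 + x)^k`
  have hA : (1 + 4 * x) ^ e ≤ (4 : ℝ) ^ k * (1 + x) ^ k := by
    calc (1 + 4 * x) ^ e ≤ (1 + 4 * x) ^ (k : ℝ) := Real.rpow_le_rpow_of_exponent_le h14 hek
      _ = (1 + 4 * x) ^ k := Real.rpow_natCast _ _
      _ ≤ (4 * (1 + x)) ^ k := by gcongr; linarith
      _ = 4 ^ k * (1 + x) ^ k := mul_pow _ _ _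
  have hB := one_add_pow_mul_exp_neg_le k hx
  -- combine
  rw [Real.rpow_neg hpos.le, ← div_eq_mul_inv, le_div_iff₀ (Real.rpow_pos_of_pos hpos e)]
  calc Real.exp (-x) * (1 + 4 * x) ^ e ≤ Real.exp (-x) * (4 ^ k * (1 + x) ^ k) := by gcongr
    _ = 4 ^ k * ((1 + x) ^ k * Real.exp (-x)) := by ring
    _ ≤ 4 ^ k * (2 ^ k * (1 + k.factorial)) := by gcongr
    _ = 8 ^ k * (1 + k.factorial) := by
        rw [← mul_assoc, ← mul_pow]; norm_num

end Elementary

variable {E : Type*} [NormedAddCommGroup E] [InnerProductSpace ℝ E]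

/-! ## The heat kernel against the parabolic distance `s + ‖z‖²` -/

section HeatKernelBound

/-- The normalising constant of the heat kernel is at most `s^{-d/2}`: `(4πs)^{-d/2} ≤ s^{-d/2}`
(`4π ≥ 1`). [folklore] -/
theorem four_pi_mul_rpow_neg_le {s : ℝ} (hs : 0 < s) :
    (4 * π * s) ^ (-(Module.finrank ℝ E : ℝ) / 2) ≤ s ^ (-(Module.finrank ℝ E : ℝ) / 2) := by
  have h4π : (1 : ℝ) ≤ 4 * π := by
    have := Real.two_le_pi; linarith
  rw [Real.mul_rpow (by positivity) hs.le]
  refine mul_le_of_le_one_left (Real.rpow_nonneg hs.le _) ?_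
  refine Real.rpow_le_one_of_one_le_of_nonpos h4π ?_
  have : (0 : ℝ) ≤ Module.finrank ℝ E := Nat.cast_nonneg _
  linarith [div_nonneg this zero_le_two]

/-- **The heat kernel against the parabolic distance.** For every real `e` there is `C` with
`G_s(z) ≤ C s^{e - d/2} (s + ‖z‖²)^{-e}` for all `s > 0`, `z` (Gaussian decay beats any power of
`(s + ‖z‖²)/s = 1 + ‖z‖²/s`). This is the scalar inequality behind Koch–Tataru's kernel bounds
(8) and (14). [cite: KochTataruAdvMath2001, §2 (8)] -/
theorem exists_heatKernel_le_rpow (e : ℝ) :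
    ∃ C : ℝ, 0 < C ∧ ∀ {s : ℝ}, 0 < s → ∀ z : E,
      UnboundedOperators.heatKernel s z ≤
        C * s ^ (e - (Module.finrank ℝ E : ℝ) / 2) * (s + ‖z‖ ^ 2) ^ (-e) := by
  obtain ⟨k, hk⟩ := exists_nat_ge e
  refine ⟨8 ^ k * (1 + k.factorial), by positivity, fun {s} hs z => ?_⟩
  set d : ℝ := (Module.finrank ℝ E : ℝ) with hd
  set x : ℝ := ‖z‖ ^ 2 / (4 * s) with hx
  have hx0 : 0 ≤ x := by positivity
  have hexp : Real.exp (-‖z‖ ^ 2 / (4 * s)) = Real.exp (-x) := by rw [hx, neg_div]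
  -- `(1 + 4x)^{-e} = s^e (s + ‖z‖²)^{-e}`
  have h14x : (1 + 4 * x) = (s + ‖z‖ ^ 2) / s := by
    rw [hx]; field_simp
  have hsz : 0 < s + ‖z‖ ^ 2 := by positivity
  have hrpow : (1 + 4 * x) ^ (-e) = s ^ e * (s + ‖z‖ ^ 2) ^ (-e) := by
    rw [h14x, Real.div_rpow hsz.le hs.le, Real.rpow_neg hsz.le, Real.rpow_neg hs.le]
    field_simp
  have hmain := exp_neg_le_mul_one_add_rpow_neg hk hx0
  rw [hrpow] at hmain
  unfold UnboundedOperators.heatKernel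
  calc (4 * π * s) ^ (-d / 2) * Real.exp (-‖z‖ ^ 2 / (4 * s))
      ≤ s ^ (-d / 2) * (8 ^ k * (1 + k.factorial) * (s ^ e * (s + ‖z‖ ^ 2) ^ (-e))) := by
        rw [hexp]
        exact mul_le_mul (four_pi_mul_rpow_neg_le hs) hmain (Real.exp_pos _).le
          (Real.rpow_nonneg hs.le _)
    _ = 8 ^ k * (1 + k.factorial) * (s ^ (-d / 2) * s ^ e) * (s + ‖z‖ ^ 2) ^ (-e) := by ring
    _ = 8 ^ k * (1 + k.factorial) * s ^ (e - d / 2) * (s + ‖z‖ ^ 2) ^ (-e) := by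
        rw [← Real.rpow_add hs]; ring_nf

end HeatKernelBound

/-! ## Power integrals on half-lines -/

section PowerIntegrals

/-- Translation on a half-line: `∫_{s > τ} f(s + c) ds = ∫_{u > τ + c} f(u) du`. [folklore] -/
theorem setIntegral_Ioi_comp_add_right (f : ℝ → ℝ) (τ c : ℝ) :
    ∫ s in Ioi τ, f (s + c) = ∫ u in Ioi (τ + c), f u := by
  have := (measurePreserving_add_right volume c).setIntegral_preimage_emb
    (measurableEmbedding_addRight c) f (Ioi (τ + c))
  simpa [preimage_add_const_Ioi] using this

/-- Translation on a half-line, integrability: `s ↦ f(s + c)` is integrable on `(τ, ∞)` iff `f` is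
integrable on `(τ + c, ∞)`. [folklore] -/
theorem integrableOn_Ioi_comp_add_right (f : ℝ → ℝ) (τ c : ℝ) :
    IntegrableOn (fun s => f (s + c)) (Ioi τ) ↔ IntegrableOn f (Ioi (τ + c)) := by
  have := (measurePreserving_add_right volume c).integrableOn_comp_preimage
    (measurableEmbedding_addRight c) (f := f) (s := Ioi (τ + c))
  simpa [preimage_add_const_Ioi, Function.comp_def] using this

/-- `∫_{s > τ} (s + ρ)^a ds = (τ + ρ)^{a+1} / (-(a+1))` for `a < -1`, `0 < τ + ρ`, and the integrand
is integrable. [folklore] -/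
theorem integral_Ioi_add_rpow {a τ ρ : ℝ} (ha : a < -1) (hτρ : 0 < τ + ρ) :
    IntegrableOn (fun s => (s + ρ) ^ a) (Ioi τ) ∧
      ∫ s in Ioi τ, (s + ρ) ^ a = (τ + ρ) ^ (a + 1) / (-(a + 1)) := by
  refine ⟨(integrableOn_Ioi_comp_add_right (fun u => u ^ a) τ ρ).2
    (integrableOn_Ioi_rpow_of_lt ha hτρ), ?_⟩
  rw [setIntegral_Ioi_comp_add_right (fun u => u ^ a) τ ρ, integral_Ioi_rpow_of_lt ha hτρ]
  rw [neg_div, div_neg]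

end PowerIntegrals

/-! ## The Gaussian weights `A`, `B` -/

section Weights

/-- The heat kernel is continuous in time on `(0, ∞)` at a fixed point. [folklore] -/
theorem continuousOn_heatKernel_time (z : E) :
    ContinuousOn (fun s => UnboundedOperators.heatKernel s z) (Ioi 0) := by
  have h := (UnboundedOperators.contDiffOn_uncurry_heatKernel (E := E) (m := 0)).continuousOn
  have hmap : ContinuousOn (fun s : ℝ => (s, z)) (Ioi 0) := by fun_prop
  exact h.comp hmap fun s hs => ⟨hs, mem_univ _⟩

/-- **Tails of the Gaussian moments.** For `n ≥ 2` and `c > 0` there is `C` such that for all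
`τ > 0`, `z`: `s ↦ G_s(z)/(c sⁿ)` is integrable on `(τ, ∞)` and
`∫_τ^∞ G_s(z)/(c sⁿ) ds ≤ C (τ + ‖z‖²)^{-(d/2 + n - 1)}` (from `exists_heatKernel_le_rpow` with
`e = d/2 + n` and `∫_τ^∞ (s + ‖z‖²)^{-d/2-n} ds = (τ + ‖z‖²)^{-d/2-n+1}/(d/2+n-1)`); the cases
`(n, c) = (2, 4), (3, 8)` are the weights `A`, `B` of the Oseen–Koch–Tataru kernel
(Koch–Tataru 2001, §2, (6)–(8)). [cite: KochTataruAdvMath2001, §2 (6)–(8)] -/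
theorem exists_setIntegral_heatKernel_div_le {n : ℕ} (hn : 2 ≤ n) {c : ℝ} (hc : 0 < c) :
    ∃ C : ℝ, 0 < C ∧ ∀ {τ : ℝ}, 0 < τ → ∀ z : E,
      IntegrableOn (fun s => UnboundedOperators.heatKernel s z / (c * s ^ n)) (Ioi τ) ∧
        ∫ s in Ioi τ, UnboundedOperators.heatKernel s z / (c * s ^ n) ≤
          C * (τ + ‖z‖ ^ 2) ^ (-((Module.finrank ℝ E : ℝ) / 2 + n - 1)) := by
  set d : ℝ := (Module.finrank ℝ E : ℝ) with hd
  have hd0 : 0 ≤ d := Nat.cast_nonneg _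
  have hn2 : (2 : ℝ) ≤ n := by exact_mod_cast hn
  obtain ⟨C₀, hC₀, hG⟩ := exists_heatKernel_le_rpow (E := E) (d / 2 + n)
  -- the exponent of the comparison integrand
  set a : ℝ := -(d / 2 + n) with ha
  have ha1 : a < -1 := by rw [ha]; linarith
  have hexp : -(a + 1) = d / 2 + n - 1 := by rw [ha]; ring
  have hpos : 0 < d / 2 + n - 1 := by linarith
  refine ⟨C₀ / c / (d / 2 + n - 1), div_pos (div_pos hC₀ hc) hpos, fun {τ} hτ z => ?_⟩
  have hτρ : 0 < τ + ‖z‖ ^ 2 := by positivity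
  obtain ⟨hint, hval⟩ := integral_Ioi_add_rpow (ρ := ‖z‖ ^ 2) ha1 hτρ
  -- pointwise comparison on `(τ, ∞)`
  have hpt : ∀ s ∈ Ioi τ, UnboundedOperators.heatKernel s z / (c * s ^ n) ≤
      C₀ / c * (s + ‖z‖ ^ 2) ^ a := by
    intro s hs
    have hs0 : 0 < s := hτ.trans hs
    have h1 := hG hs0 z
    have hse : s ^ (d / 2 + ↑n - d / 2) = s ^ n := by
      rw [add_sub_cancel_left, Real.rpow_natCast]
    rw [hse] at h1
    rw [div_le_iff₀ (by positivity)]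
    calc UnboundedOperators.heatKernel s z ≤ C₀ * s ^ n * (s + ‖z‖ ^ 2) ^ (-(d / 2 + n)) := h1
      _ = C₀ / c * (s + ‖z‖ ^ 2) ^ a * (c * s ^ n) := by rw [ha]; field_simp
  have hmeas : AEStronglyMeasurable (fun s => UnboundedOperators.heatKernel s z / (c * s ^ n))
      (volume.restrict (Ioi τ)) := by
    refine ContinuousOn.aestronglyMeasurable ?_ measurableSet_Ioi
    refine ((continuousOn_heatKernel_time z).mono (Ioi_subset_Ioi hτ.le)).div (by fun_prop) ?_
    intro s hs
    exact mul_ne_zero hc.ne' (pow_ne_zero _ (hτ.trans hs).ne')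
  have hnn : ∀ s ∈ Ioi τ, 0 ≤ UnboundedOperators.heatKernel s z / (c * s ^ n) := fun s hs =>
    div_nonneg (UnboundedOperators.heatKernel_pos (hτ.trans hs) z).le
      (mul_nonneg hc.le (pow_nonneg (hτ.trans hs).le _))
  have hint' : IntegrableOn (fun s => C₀ / c * (s + ‖z‖ ^ 2) ^ a) (Ioi τ) := hint.const_mul _
  refine ⟨hint'.mono' hmeas ?_, ?_⟩
  · refine (ae_restrict_iff' measurableSet_Ioi).2 (Eventually.of_forall fun s hs => ?_)
    rw [Real.norm_of_nonneg (hnn s hs)]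
    exact hpt s hs
  · calc ∫ s in Ioi τ, UnboundedOperators.heatKernel s z / (c * s ^ n)
        ≤ ∫ s in Ioi τ, C₀ / c * (s + ‖z‖ ^ 2) ^ a :=
          setIntegral_mono_on (hint'.mono' hmeas ((ae_restrict_iff' measurableSet_Ioi).2
            (Eventually.of_forall fun s hs => by
              rw [Real.norm_of_nonneg (hnn s hs)]; exact hpt s hs))) hint' measurableSet_Ioi hpt
      _ = C₀ / c * ((τ + ‖z‖ ^ 2) ^ (a + 1) / (-(a + 1))) := by
          rw [integral_const_mul, hval]
      _ = C₀ / c / (d / 2 + n - 1) * (τ + ‖z‖ ^ 2) ^ (-(d / 2 + n - 1)) := by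
          rw [hexp, show a + 1 = -(d / 2 + n - 1) by rw [ha]; ring]
          field_simp

/-- **The first Gaussian weight is controlled by the parabolic distance**: there is `C = C(E)`
with `0 ≤ A(τ, z) ≤ C (τ + ‖z‖²)^{-d/2-1}` for all `τ > 0`, `z`, and the defining integral of
`A = oseenWeightA` is absolutely convergent (Koch–Tataru 2001, §2, (8): the kernel of `Π∇S(t)` is
`O((√t + |x|)^{-n-1})`). [cite: KochTataruAdvMath2001, §2 (8)] -/
theorem exists_oseenWeightA_le :
    ∃ C : ℝ, 0 < C ∧ ∀ {τ : ℝ}, 0 < τ → ∀ z : E,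
      IntegrableOn (fun s => UnboundedOperators.heatKernel s z / (4 * s ^ 2)) (Ioi τ) ∧
        0 ≤ oseenWeightA τ z ∧
        oseenWeightA τ z ≤ C * (τ + ‖z‖ ^ 2) ^ (-((Module.finrank ℝ E : ℝ) / 2 + 1)) := by
  obtain ⟨C, hC, h⟩ := exists_setIntegral_heatKernel_div_le (E := E) (n := 2) le_rfl
    (c := 4) (by norm_num)
  refine ⟨C, hC, fun {τ} hτ z => ?_⟩
  obtain ⟨hint, hle⟩ := h hτ z
  refine ⟨hint, ?_, ?_⟩
  · exact setIntegral_nonneg measurableSet_Ioi fun s hs =>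
      div_nonneg (UnboundedOperators.heatKernel_pos (hτ.trans hs) z).le
        (mul_nonneg (by norm_num) (pow_nonneg (hτ.trans hs).le _))
  · have : -((Module.finrank ℝ E : ℝ) / 2 + (2 : ℕ) - 1) = -((Module.finrank ℝ E : ℝ) / 2 + 1) := by
      push_cast; ring
    rw [this] at hle
    exact hle

/-- **The second Gaussian weight is controlled by the parabolic distance**: there is `C = C(E)`
with `0 ≤ B(τ, z) ≤ C (τ + ‖z‖²)^{-d/2-2}` for all `τ > 0`, `z`, and the defining integral of
`B = oseenWeightB` is absolutely convergent (Koch–Tataru 2001, §2, (8)). [cite: KochTataruAdvMath2001, §2 (8)] -/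
theorem exists_oseenWeightB_le :
    ∃ C : ℝ, 0 < C ∧ ∀ {τ : ℝ}, 0 < τ → ∀ z : E,
      IntegrableOn (fun s => UnboundedOperators.heatKernel s z / (8 * s ^ 3)) (Ioi τ) ∧
        0 ≤ oseenWeightB τ z ∧
        oseenWeightB τ z ≤ C * (τ + ‖z‖ ^ 2) ^ (-((Module.finrank ℝ E : ℝ) / 2 + 2)) := by
  obtain ⟨C, hC, h⟩ := exists_setIntegral_heatKernel_div_le (E := E) (n := 3) (by norm_num)
    (c := 8) (by norm_num)
  refine ⟨C, hC, fun {τ} hτ z => ?_⟩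
  obtain ⟨hint, hle⟩ := h hτ z
  refine ⟨hint, ?_, ?_⟩
  · exact setIntegral_nonneg measurableSet_Ioi fun s hs =>
      div_nonneg (UnboundedOperators.heatKernel_pos (hτ.trans hs) z).le
        (mul_nonneg (by norm_num) (pow_nonneg (hτ.trans hs).le _))
  · have : -((Module.finrank ℝ E : ℝ) / 2 + (3 : ℕ) - 1) = -((Module.finrank ℝ E : ℝ) / 2 + 2) := by
      push_cast; ring
    rw [this] at hle
    exact hle

end Weights

/-! ## Koch–Tataru's kernel bound (14) -/

section KernelBound

/-- `‖z‖ ≤ (τ + ‖z‖²)^{1/2}` for `τ ≥ 0`. [folklore] -/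
theorem norm_le_add_sq_rpow_half {V : Type*} [SeminormedAddCommGroup V] {τ : ℝ} (hτ : 0 ≤ τ)
    (z : V) :
    ‖z‖ ≤ (τ + ‖z‖ ^ 2) ^ (1 / 2 : ℝ) := by
  rw [← Real.sqrt_eq_rpow]
  calc ‖z‖ = Real.sqrt (‖z‖ ^ 2) := (Real.sqrt_sq (norm_nonneg z)).symm
    _ ≤ Real.sqrt (τ + ‖z‖ ^ 2) := Real.sqrt_le_sqrt (by linarith)

/-- **Koch–Tataru's kernel bound (14)** (Adv. Math. 157 (2001), §3, (14):
`|K(x, t)| ≤ c (√t + |x|)^{-n-1}` for the kernel of `V∇Π`, from (8)), for the explicit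
Oseen–Koch–Tataru kernel of `KochTataru.lean` and in the equivalent parabolic form: there is
`C = C(E)` such that `‖K(τ, z)[a, b]‖ ≤ C (τ + ‖z‖²)^{-(d+1)/2} ‖a‖ ‖b‖` for all `τ > 0` and
`z, a, b ∈ E` (note `(√τ + ‖z‖)² ≤ 2(τ + ‖z‖²) ≤ 2(√τ + ‖z‖)²`). Proof: the three terms of
`norm_oseenKernel_le` are bounded by `exists_heatKernel_le_rpow` (`e = d/2 + 1`) and
`exists_oseenWeightA_le`, `exists_oseenWeightB_le`, using `‖z‖ ≤ (τ + ‖z‖²)^{1/2}`. [cite: KochTataruAdvMath2001, §3 (14)] -/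
theorem exists_norm_oseenKernel_le :
    ∃ C : ℝ, 0 < C ∧ ∀ {τ : ℝ}, 0 < τ → ∀ z a b : E,
      ‖oseenKernel τ z a b‖ ≤
        C * (τ + ‖z‖ ^ 2) ^ (-(((Module.finrank ℝ E : ℝ) + 1) / 2)) * ‖a‖ * ‖b‖ := by
  set d : ℝ := (Module.finrank ℝ E : ℝ) with hd
  obtain ⟨C₁, hC₁, hG⟩ := exists_heatKernel_le_rpow (E := E) (d / 2 + 1)
  obtain ⟨C₂, hC₂, hA⟩ := exists_oseenWeightA_le (E := E)
  obtain ⟨C₃, hC₃, hB⟩ := exists_oseenWeightB_le (E := E)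
  refine ⟨C₁ / 2 + 3 * C₂ + C₃, by positivity, fun {τ} hτ z a b => ?_⟩
  set ρ : ℝ := τ + ‖z‖ ^ 2 with hρ
  have hρ0 : 0 < ρ := by positivity
  have hzρ : ‖z‖ ≤ ρ ^ (1 / 2 : ℝ) := norm_le_add_sq_rpow_half hτ.le z
  have hmain := norm_oseenKernel_le τ z a b
  -- the target power
  have hpow1 : ρ ^ (-(d / 2 + 1)) * ρ ^ (1 / 2 : ℝ) = ρ ^ (-((d + 1) / 2)) := by
    rw [← Real.rpow_add hρ0]; ring_nf
  have hpow3 : ρ ^ (-(d / 2 + 2)) * (ρ ^ (1 / 2 : ℝ)) ^ 3 = ρ ^ (-((d + 1) / 2)) := by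
    rw [← Real.rpow_natCast, ← Real.rpow_mul hρ0.le, ← Real.rpow_add hρ0]; ring_nf
  -- term 1: `‖z‖ G_τ(z) / (2τ)`
  have h1 : ‖z‖ * |UnboundedOperators.heatKernel τ z| / (2 * |τ|) ≤ C₁ / 2 * ρ ^ (-((d + 1) / 2)) := by
    rw [abs_of_pos (UnboundedOperators.heatKernel_pos hτ z), abs_of_pos hτ]
    have hG' := hG hτ z
    have hτe : τ ^ (d / 2 + 1 - d / 2) = τ := by ring_nf; exact Real.rpow_one τ
    rw [hτe] at hG'
    calc ‖z‖ * UnboundedOperators.heatKernel τ z / (2 * τ)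
        ≤ ρ ^ (1 / 2 : ℝ) * (C₁ * τ * ρ ^ (-(d / 2 + 1))) / (2 * τ) := by
          gcongr
          exact (UnboundedOperators.heatKernel_pos hτ z).le
      _ = C₁ / 2 * (ρ ^ (-(d / 2 + 1)) * ρ ^ (1 / 2 : ℝ)) := by field_simp
      _ = C₁ / 2 * ρ ^ (-((d + 1) / 2)) := by rw [hpow1]
  -- term 2: `3 A ‖z‖`
  have h2 : 3 * |oseenWeightA τ z| * ‖z‖ ≤ 3 * C₂ * ρ ^ (-((d + 1) / 2)) := by
    obtain ⟨-, hA0, hAle⟩ := hA hτ z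
    rw [abs_of_nonneg hA0]
    calc 3 * oseenWeightA τ z * ‖z‖ ≤ 3 * (C₂ * ρ ^ (-(d / 2 + 1))) * ρ ^ (1 / 2 : ℝ) := by gcongr
      _ = 3 * C₂ * (ρ ^ (-(d / 2 + 1)) * ρ ^ (1 / 2 : ℝ)) := by ring
      _ = 3 * C₂ * ρ ^ (-((d + 1) / 2)) := by rw [hpow1]
  -- term 3: `B ‖z‖³`
  have h3 : |oseenWeightB τ z| * ‖z‖ ^ 3 ≤ C₃ * ρ ^ (-((d + 1) / 2)) := by
    obtain ⟨-, hB0, hBle⟩ := hB hτ z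
    rw [abs_of_nonneg hB0]
    calc oseenWeightB τ z * ‖z‖ ^ 3 ≤ C₃ * ρ ^ (-(d / 2 + 2)) * (ρ ^ (1 / 2 : ℝ)) ^ 3 := by gcongr
      _ = C₃ * (ρ ^ (-(d / 2 + 2)) * (ρ ^ (1 / 2 : ℝ)) ^ 3) := by ring
      _ = C₃ * ρ ^ (-((d + 1) / 2)) := by rw [hpow3]
  calc ‖oseenKernel τ z a b‖
      ≤ (‖z‖ * |UnboundedOperators.heatKernel τ z| / (2 * |τ|) + 3 * |oseenWeightA τ z| * ‖z‖ +
          |oseenWeightB τ z| * ‖z‖ ^ 3) * ‖a‖ * ‖b‖ := hmain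
    _ ≤ (C₁ / 2 * ρ ^ (-((d + 1) / 2)) + 3 * C₂ * ρ ^ (-((d + 1) / 2)) +
          C₃ * ρ ^ (-((d + 1) / 2))) * ‖a‖ * ‖b‖ := by gcongr
    _ = (C₁ / 2 + 3 * C₂ + C₃) * ρ ^ (-((d + 1) / 2)) * ‖a‖ * ‖b‖ := by ring

/-- Koch–Tataru's kernel bound (14) in `ℝ≥0∞`:
`‖K(τ, z)[a, b]‖ₑ ≤ ofReal (C (τ + ‖z‖²)^{-(d+1)/2}) ‖a‖ₑ ‖b‖ₑ` for `τ > 0`, the form consumed by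
`∫⁻` estimates. [cite: KochTataruAdvMath2001, §3 (14)] -/
theorem exists_enorm_oseenKernel_le :
    ∃ C : ℝ, 0 < C ∧ ∀ {τ : ℝ}, 0 < τ → ∀ z a b : E,
      ‖oseenKernel τ z a b‖ₑ ≤
        ENNReal.ofReal (C * (τ + ‖z‖ ^ 2) ^ (-(((Module.finrank ℝ E : ℝ) + 1) / 2))) *
          ‖a‖ₑ * ‖b‖ₑ := by
  obtain ⟨C, hC, hK⟩ := exists_norm_oseenKernel_le (E := E)
  refine ⟨C, hC, fun {τ} hτ z a b => ?_⟩
  rw [← ofReal_norm, ← ofReal_norm, ← ofReal_norm, ← ENNReal.ofReal_mul (by positivity),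
    ← ENNReal.ofReal_mul (by positivity)]
  exact ENNReal.ofReal_le_ofReal (hK hτ z a b)

end KernelBound

/-! ## Measurability of the weights and of the kernel -/

section Measurability

variable [MeasurableSpace E] [BorelSpace E]

/-- The heat kernel is jointly measurable in `(t, x)` on all of `ℝ × E` (junk values included).
[folklore] -/
theorem measurable_heatKernel_uncurry :
    Measurable (fun p : ℝ × E => UnboundedOperators.heatKernel p.1 p.2) := by
  unfold UnboundedOperators.heatKernel
  fun_prop

/-- Joint measurability of a half-line Gaussian moment `(τ, z) ↦ ∫_τ^∞ G_s(z)/(c sⁿ) ds` on all of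
`ℝ × E` (the variable domain `(τ, ∞)` is an indicator of the measurable set `{τ < s}`; Fubini
measurability `StronglyMeasurable.integral_prod_right`). [folklore] -/
theorem stronglyMeasurable_setIntegral_Ioi_heatKernel_div (c : ℝ) (n : ℕ) :
    StronglyMeasurable (fun p : ℝ × E =>
      ∫ s in Ioi p.1, UnboundedOperators.heatKernel s p.2 / (c * s ^ n)) := by
  set F : ℝ × E → ℝ → ℝ := fun p s =>
    if p.1 < s then UnboundedOperators.heatKernel s p.2 / (c * s ^ n) else 0 with hF
  have hFm : Measurable (uncurry F) := by
    refine Measurable.ite (measurableSet_lt measurable_fst.fst measurable_snd) ?_ measurable_const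
    have hG : Measurable (fun q : (ℝ × E) × ℝ => UnboundedOperators.heatKernel q.2 q.1.2) :=
      measurable_heatKernel_uncurry.comp (measurable_snd.prodMk measurable_fst.snd)
    exact hG.div (measurable_const.mul (measurable_snd.pow_const n))
  have hint : StronglyMeasurable (fun p : ℝ × E => ∫ s, F p s) :=
    StronglyMeasurable.integral_prod_right hFm.stronglyMeasurable
  have heq : (fun p : ℝ × E => ∫ s in Ioi p.1, UnboundedOperators.heatKernel s p.2 / (c * s ^ n)) =
      fun p => ∫ s, F p s := by
    funext p
    rw [← integral_indicator measurableSet_Ioi]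
    congr 1
  rw [heq]
  exact hint

/-- **The first Gaussian weight is jointly measurable** in `(τ, z)` on all of `ℝ × E`
(junk values at `τ ≤ 0` included; Koch–Tataru 2001, §2). [cite: KochTataruAdvMath2001, §2 (6)–(8)] -/
theorem stronglyMeasurable_oseenWeightA :
    StronglyMeasurable (fun p : ℝ × E => oseenWeightA p.1 p.2) := by
  unfold oseenWeightA
  exact stronglyMeasurable_setIntegral_Ioi_heatKernel_div 4 2

/-- **The second Gaussian weight is jointly measurable** in `(τ, z)` on all of `ℝ × E`
(Koch–Tataru 2001, §2). [cite: KochTataruAdvMath2001, §2 (6)–(8)] -/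
theorem stronglyMeasurable_oseenWeightB :
    StronglyMeasurable (fun p : ℝ × E => oseenWeightB p.1 p.2) := by
  unfold oseenWeightB
  exact stronglyMeasurable_setIntegral_Ioi_heatKernel_div 8 3

/-- **The Oseen–Koch–Tataru kernel is jointly measurable** in all its arguments
`(τ, z, a, b) ∈ ℝ × E × E × E` (junk values at `τ ≤ 0` included): it is an algebraic expression in
the measurable scalar weights `G_τ(z)`, `A(τ, z)`, `B(τ, z)` and inner products (Koch–Tataru
2001, §2, (8)). [cite: KochTataruAdvMath2001, §2 (8)] -/
theorem measurable_oseenKernel [FiniteDimensional ℝ E] :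
    Measurable (fun q : ℝ × E × E × E => oseenKernel q.1 q.2.1 q.2.2.1 q.2.2.2) := by
  have hA : Measurable (fun p : ℝ × E => oseenWeightA p.1 p.2) :=
    stronglyMeasurable_oseenWeightA.measurable
  have hB : Measurable (fun p : ℝ × E => oseenWeightB p.1 p.2) :=
    stronglyMeasurable_oseenWeightB.measurable
  have hG : Measurable (fun p : ℝ × E => UnboundedOperators.heatKernel p.1 p.2) :=
    measurable_heatKernel_uncurry
  have hA' : Measurable (fun q : ℝ × E × E × E => oseenWeightA q.1 q.2.1) :=
    hA.comp (measurable_fst.prodMk measurable_snd.fst)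
  have hB' : Measurable (fun q : ℝ × E × E × E => oseenWeightB q.1 q.2.1) :=
    hB.comp (measurable_fst.prodMk measurable_snd.fst)
  have hG' : Measurable (fun q : ℝ × E × E × E => UnboundedOperators.heatKernel q.1 q.2.1) :=
    hG.comp (measurable_fst.prodMk measurable_snd.fst)
  have hz : Measurable (fun q : ℝ × E × E × E => q.2.1) := measurable_snd.fst
  have ha : Measurable (fun q : ℝ × E × E × E => q.2.2.1) := measurable_snd.snd.fst
  have hb : Measurable (fun q : ℝ × E × E × E => q.2.2.2) := measurable_snd.snd.snd
  have hτ : Measurable (fun q : ℝ × E × E × E => q.1) := measurable_fst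
  have hza : Measurable (fun q : ℝ × E × E × E => ⟪q.2.1, q.2.2.1⟫) := hz.inner ha
  have hzb : Measurable (fun q : ℝ × E × E × E => ⟪q.2.1, q.2.2.2⟫) := hz.inner hb
  have hab : Measurable (fun q : ℝ × E × E × E => ⟪q.2.2.1, q.2.2.2⟫) := ha.inner hb
  have h1 : Measurable (fun q : ℝ × E × E × E =>
      (-(⟪q.2.1, q.2.2.1⟫ / (2 * q.1) * UnboundedOperators.heatKernel q.1 q.2.1)) • q.2.2.2) :=
    ((hza.div (measurable_const.mul hτ)).mul hG').neg.smul hb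
  have h2 : Measurable (fun q : ℝ × E × E × E =>
      oseenWeightA q.1 q.2.1 • (⟪q.2.1, q.2.2.1⟫ • q.2.2.2 + ⟪q.2.2.1, q.2.2.2⟫ • q.2.1 +
        ⟪q.2.1, q.2.2.2⟫ • q.2.2.1)) :=
    hA'.smul (((hza.smul hb).add (hab.smul hz)).add (hzb.smul ha))
  have h3 : Measurable (fun q : ℝ × E × E × E =>
      (oseenWeightB q.1 q.2.1 * (⟪q.2.1, q.2.2.1⟫ * ⟪q.2.1, q.2.2.2⟫)) • q.2.1) :=
    (hB'.mul (hza.mul hzb)).smul hz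
  exact (h1.add h2).sub h3

/-- Measurability of the kernel in `z` at fixed `τ, a, b`. [folklore] -/
theorem measurable_oseenKernel_left [FiniteDimensional ℝ E] (τ : ℝ) (a b : E) :
    Measurable (fun z : E => oseenKernel τ z a b) := by
  have h : Measurable (fun z : E => ((τ, z, a, b) : ℝ × E × E × E)) := by fun_prop
  exact measurable_oseenKernel.comp h

end Measurability

/-! ## Integrals of the parabolic weights and the `L¹` size of the kernel -/

section Integrals

variable [FiniteDimensional ℝ E] [MeasurableSpace E] [BorelSpace E]

/-- The normalising integral `∫ (1 + ‖w‖²)^{-e} dw` is finite for `2e > d`. [folklore] -/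
theorem integrable_one_add_norm_sq_rpow_neg {e : ℝ} (he : (Module.finrank ℝ E : ℝ) < 2 * e) :
    Integrable (fun w : E => (1 + ‖w‖ ^ 2) ^ (-e)) := by
  have h := integrable_rpow_neg_one_add_norm_sq (E := E) (μ := volume) (r := 2 * e) he
  have h2 : -(2 * e) / 2 = -e := by ring
  simpa only [h2] using h

/-- The normalising integral `∫ (1 + ‖w‖²)^{-e} dw` is positive for `2e > d`. [folklore] -/
theorem integral_one_add_norm_sq_rpow_neg_pos {e : ℝ} (he : (Module.finrank ℝ E : ℝ) < 2 * e) :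
    0 < ∫ w : E, (1 + ‖w‖ ^ 2) ^ (-e) := by
  refine (integral_pos_iff_support_of_nonneg (fun w => ?_) (integrable_one_add_norm_sq_rpow_neg he)).2 ?_
  · exact Real.rpow_nonneg (by positivity) _
  · have : support (fun w : E => (1 + ‖w‖ ^ 2) ^ (-e)) = univ := by
      refine eq_univ_of_forall fun w => ?_
      exact (Real.rpow_pos_of_pos (by positivity) _).ne'
    rw [this]
    exact Measure.measure_univ_pos.2 (NeZero.ne _)

/-- **Parabolic scaling of the weights**: `∫ (τ + ‖z‖²)^{-e} dz = τ^{d/2 - e} ∫ (1 + ‖w‖²)^{-e} dw`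
for `τ > 0` (substitution `z = √τ w`). [folklore] -/
theorem integral_add_norm_sq_rpow_neg {τ : ℝ} (hτ : 0 < τ) (e : ℝ) :
    ∫ z : E, (τ + ‖z‖ ^ 2) ^ (-e) =
      τ ^ ((Module.finrank ℝ E : ℝ) / 2 - e) * ∫ w : E, (1 + ‖w‖ ^ 2) ^ (-e) := by
  set d : ℝ := (Module.finrank ℝ E : ℝ) with hd
  set R : ℝ := Real.sqrt τ with hR
  have hR0 : 0 < R := Real.sqrt_pos.2 hτ
  have hR2 : R ^ 2 = τ := Real.sq_sqrt hτ.le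
  -- `f (R • w) = τ^{-e} (1 + ‖w‖²)^{-e}`
  have hcomp : ∀ w : E, (τ + ‖R • w‖ ^ 2) ^ (-e) = τ ^ (-e) * (1 + ‖w‖ ^ 2) ^ (-e) := by
    intro w
    rw [norm_smul, Real.norm_of_nonneg hR0.le, mul_pow, hR2, ← Real.mul_rpow hτ.le (by positivity)]
    congr 1; ring
  have hscale := Measure.integral_comp_smul (volume : Measure E) (fun z : E => (τ + ‖z‖ ^ 2) ^ (-e)) R
  simp only [hcomp, integral_const_mul] at hscale
  -- `|(R^d)⁻¹| = τ^{-d/2}`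
  have hRd : |(R ^ Module.finrank ℝ E)⁻¹| = τ ^ (-(d / 2)) := by
    rw [abs_of_pos (by positivity), ← Real.rpow_natCast, hR, Real.sqrt_eq_rpow, ← Real.rpow_mul hτ.le,
      ← Real.rpow_neg hτ.le]
    congr 1; rw [hd]; ring
  rw [hRd, smul_eq_mul] at hscale
  -- solve for `∫ f`
  have hτd : τ ^ (-(d / 2)) ≠ 0 := (Real.rpow_pos_of_pos hτ _).ne'
  have key : ∫ z : E, (τ + ‖z‖ ^ 2) ^ (-e) =
      (τ ^ (-(d / 2)))⁻¹ * (τ ^ (-e) * ∫ w : E, (1 + ‖w‖ ^ 2) ^ (-e)) := by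
    rw [hscale, ← mul_assoc, inv_mul_cancel₀ hτd, one_mul]
  rw [key, ← Real.rpow_neg_one, ← Real.rpow_mul hτ.le, ← mul_assoc, ← Real.rpow_add hτ]
  congr 1; ring_nf

/-- The weights `(τ + ‖z‖²)^{-e}`, `2e > d`, are integrable for `τ > 0`. [folklore] -/
theorem integrable_add_norm_sq_rpow_neg {e : ℝ} (he : (Module.finrank ℝ E : ℝ) < 2 * e) {τ : ℝ}
    (hτ : 0 < τ) : Integrable (fun z : E => (τ + ‖z‖ ^ 2) ^ (-e)) := by
  set R : ℝ := Real.sqrt τ with hR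
  have hR0 : 0 < R := Real.sqrt_pos.2 hτ
  have hR2 : R ^ 2 = τ := Real.sq_sqrt hτ.le
  have hcomp : (fun w : E => (τ + ‖R • w‖ ^ 2) ^ (-e)) = fun w => τ ^ (-e) * (1 + ‖w‖ ^ 2) ^ (-e) := by
    funext w
    rw [norm_smul, Real.norm_of_nonneg hR0.le, mul_pow, hR2, ← Real.mul_rpow hτ.le (by positivity)]
    congr 1; ring
  have h := (integrable_one_add_norm_sq_rpow_neg he).const_mul (τ ^ (-e))
  rw [← hcomp] at h
  exact (integrable_comp_smul_iff volume (fun z : E => (τ + ‖z‖ ^ 2) ^ (-e)) hR0.ne').1 h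

/-- `∫⁻` form of the parabolic scaling, `2e > d`:
`∫⁻ (τ + ‖z‖²)^{-e} dz = τ^{d/2-e} ∫ (1 + ‖w‖²)^{-e} dw` in `ℝ≥0∞`. [folklore] -/
theorem lintegral_add_norm_sq_rpow_neg {e : ℝ} (he : (Module.finrank ℝ E : ℝ) < 2 * e) {τ : ℝ}
    (hτ : 0 < τ) :
    ∫⁻ z : E, ENNReal.ofReal ((τ + ‖z‖ ^ 2) ^ (-e)) =
      ENNReal.ofReal (τ ^ ((Module.finrank ℝ E : ℝ) / 2 - e) * ∫ w : E, (1 + ‖w‖ ^ 2) ^ (-e)) := by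
  rw [← integral_add_norm_sq_rpow_neg hτ e, ofReal_integral_eq_lintegral_ofReal
    (integrable_add_norm_sq_rpow_neg he hτ) (Eventually.of_forall fun z => ?_)]
  exact Real.rpow_nonneg (by positivity) _

/-- **`L¹` size of the Oseen–Koch–Tataru kernel** (Koch–Tataru 2001, proof of Lemma 3.2, Step 2:
"the integrability of the kernel at `0`"): there is `C = C(E)` such that
`∫ ‖K(τ, z)[a, b]‖ dz ≤ C τ^{-1/2} ‖a‖ ‖b‖` for all `τ > 0` (in `ℝ≥0∞`), from the kernel bound
(14) and `∫ (τ + ‖z‖²)^{-(d+1)/2} dz = τ^{-1/2} ∫ (1 + ‖w‖²)^{-(d+1)/2} dw`; and `z ↦ K(τ, z)[a, b]`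
is integrable. [cite: KochTataruAdvMath2001, Lemma 3.2 (Step 2)] -/
theorem exists_lintegral_enorm_oseenKernel_le :
    ∃ C : ℝ, 0 < C ∧ ∀ {τ : ℝ}, 0 < τ → ∀ a b : E,
      Integrable (fun z : E => oseenKernel τ z a b) ∧
        ∫⁻ z, ‖oseenKernel τ z a b‖ₑ ≤ ENNReal.ofReal (C * τ ^ (-(1 / 2 : ℝ))) * ‖a‖ₑ * ‖b‖ₑ := by
  set d : ℝ := (Module.finrank ℝ E : ℝ) with hd
  obtain ⟨C, hC, hK⟩ := exists_norm_oseenKernel_le (E := E)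
  set M : ℝ := ∫ w : E, (1 + ‖w‖ ^ 2) ^ (-((d + 1) / 2)) with hM
  have he : d < 2 * ((d + 1) / 2) := by linarith
  have hM0 : 0 < M := integral_one_add_norm_sq_rpow_neg_pos he
  refine ⟨C * M, by positivity, fun {τ} hτ a b => ?_⟩
  have hw := integrable_add_norm_sq_rpow_neg (E := E) he hτ
  -- pointwise domination
  have hdom : ∀ z : E, ‖oseenKernel τ z a b‖ ≤ C * ‖a‖ * ‖b‖ * (τ + ‖z‖ ^ 2) ^ (-((d + 1) / 2)) := by
    intro z
    calc ‖oseenKernel τ z a b‖ ≤ C * (τ + ‖z‖ ^ 2) ^ (-((d + 1) / 2)) * ‖a‖ * ‖b‖ := hK hτ z a b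
      _ = C * ‖a‖ * ‖b‖ * (τ + ‖z‖ ^ 2) ^ (-((d + 1) / 2)) := by ring
  have hint : Integrable (fun z : E => oseenKernel τ z a b) :=
    (hw.const_mul (C * ‖a‖ * ‖b‖)).mono' (measurable_oseenKernel_left τ a b).aestronglyMeasurable
      (Eventually.of_forall hdom)
  refine ⟨hint, ?_⟩
  have hscal : d / 2 - (d + 1) / 2 = -(1 / 2 : ℝ) := by ring
  calc ∫⁻ z, ‖oseenKernel τ z a b‖ₑ
      ≤ ∫⁻ z, ENNReal.ofReal (C * ‖a‖ * ‖b‖) * ENNReal.ofReal ((τ + ‖z‖ ^ 2) ^ (-((d + 1) / 2))) := by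
        refine lintegral_mono fun z => ?_
        rw [← ENNReal.ofReal_mul (by positivity), ← ofReal_norm]
        exact ENNReal.ofReal_le_ofReal (hdom z)
    _ = ENNReal.ofReal (C * ‖a‖ * ‖b‖) * ENNReal.ofReal (τ ^ (-(1 / 2 : ℝ)) * M) := by
        rw [lintegral_const_mul' _ _ ENNReal.ofReal_ne_top, lintegral_add_norm_sq_rpow_neg he hτ,
          hscal]
    _ = ENNReal.ofReal (C * M * τ ^ (-(1 / 2 : ℝ))) * ‖a‖ₑ * ‖b‖ₑ := by
        rw [← ENNReal.ofReal_mul (by positivity), ← ofReal_norm, ← ofReal_norm,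
          ← ENNReal.ofReal_mul (by positivity), ← ENNReal.ofReal_mul (by positivity)]
        congr 1; ring

end Integrals

end Literature.Analysis.FluidPDE
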